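import Mathlib
import Literature.Topology.FourManifolds.SmoothTriangulation
import Summits.SmoothPoincare4.SmoothPoincare4.Theses.TropicalFanoSkeleton
import Literature.Topology.FourManifolds.DisconnectedTropicalData

/-!
# `TropicalCollapse` — negative knowledge: a skeleton certificate forces `M` connected, so the
# typed crux fails on disconnected `M` (missing `[ConnectedSpace M]`)

Refuter lemmas for crux `stmt-SmoothPoincare4-15643`
(`Summit.SmoothPoincare4.SmoothPoincare4.Theses.TropicalFanoSkeleton.TropicalCollapse`, route
`TropicalFanoSkeleton`).

* `connectedSpace_of_certificate` — the CONCLUSION of `TropicalCollapse` for `M` (a finite Euclidean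
  simplicial complex `K'` with `|K'| ≃ₜ M` and a vertex `v` whose antistar `{s ∈ K' | v ∉ s}` collapses,
  by removals of free pairs, to a single vertex `{w}`) implies `ConnectedSpace M`: collapses preserve
  down-closedness and vertex–edge connectivity of a face family, the cone vertex `v` is joined to the
  antistar because a point of a manifold modelled on `ℝ⁴` is never open, and a union of simplices whose
  vertex graph is connected is connected.
* `DisconnectedTropicalData` (the hypothesis `H` of the negative-lemma protocol) — some NON-connected
  `C^∞` 4-manifold carries a smooth triangulation `K`, a vertex `v₀` and a positive integral tropical fan
  datum `x` satisfying VERBATIM the hypothesis clauses of `TropicalCollapse`. On paper `H` holds: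
  `M = S⁴ ⊔ S⁴`, `K = ∂Δ⁵ ⊔ ∂Δ⁵` radially projected, `v₀` a vertex of the first copy carrying the route's
  calibration datum (ℙ⁴ fans, all shears `κ = 5`), the second copy carrying the CLOSED six-ℙ⁴-fan datum
  of the sextic degeneration (all shears `κ = 6`); all typed clauses are local (per vertex / per ridge) and
  were checked by exact rational arithmetic (refuter evidence `shear_check.py`, `SKELVET.md` on the item,
  and independently `compute/checker.py` of this seat: 240 + 360 shear instances, unimodularity, fan
  completeness/properness). `H` is not constructible in the tree today only because no smooth
  triangulation of a closed 4-manifold (`IsSmoothTriangulation 4 K h`, e.g. of `S⁴` by `∂Δ⁵`) has been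
  formalised (item stmt-SmoothPoincare4-13643 closed moot).
* `tropicalCollapse_false_of_disconnectedTropicalData : Literature.Topology.FourManifolds.DisconnectedTropicalData → ¬ TropicalCollapse`.

Classification: MISSTATED — the repaired crux inserts `[ConnectedSpace M]` after
`[IsManifold (𝓡 4) (⊤ : ℕ∞) M]` (the route's `closes` then feeds it from `M ≃ₕ S⁴`); the disconnected
witness misses the repaired statement. No route item is concluded positively here.
References: J. H. C. Whitehead, *Simplicial spaces, nuclei and m-groups*, Proc. LMS 45 (1939) §3
(elementary collapses) [Whitehead1939]; the connectivity argument is folklore.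
-/

noncomputable section

set_option linter.dupNamespace false

open scoped BigOperators Topology Manifold Matrix
open Set Relation Geometry

namespace Summit.SmoothPoincare4.SmoothPoincare4.Theorems.TropicalCollapse.Negative

variable {E : Type*}

/-! ## Elementary collapses on families of finite sets -/

/-- One elementary collapse, exactly the relation of the route items: remove a free pair `σ ⊂ τ`
(`τ` the unique proper coface of `σ` in `F`, of one more vertex). [cite: Whitehead1939, §3] -/
def CollapseStep (F G : Set (Finset E)) : Prop :=
  ∃ σ τ : Finset E, (σ ∈ F ∧ τ ∈ F ∧ σ ⊂ τ ∧ τ.card = σ.card + 1 ∧ ∀ ρ ∈ F, σ ⊂ ρ → ρ = τ) ∧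
    G = F \ {σ, τ}

/-- A face family is *good* if it avoids `∅` and is closed under passing to nonempty subsets. [folklore] -/
def Good (F : Set (Finset E)) : Prop :=
  ∅ ∉ F ∧ ∀ s ∈ F, ∀ t : Finset E, t ⊆ s → t.Nonempty → t ∈ F

/-- Two vertices are *linked in `F`* if they are joined by a path of edges `{a, b} ∈ F`. [folklore] -/
def Linked [DecidableEq E] (F : Set (Finset E)) (u w : E) : Prop :=
  ReflTransGen (fun a b : E => ({a, b} : Finset E) ∈ F) u w

/-- One collapse step only removes faces. [folklore] -/
theorem CollapseStep.subset {F G : Set (Finset E)} (h : CollapseStep F G) : G ⊆ F := by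
  obtain ⟨σ, τ, -, rfl⟩ := h
  exact fun s hs => hs.1

/-- A sequence of collapses only removes faces. [folklore] -/
theorem subset_of_collapses {F G : Set (Finset E)} (h : ReflTransGen CollapseStep F G) : G ⊆ F := by
  induction h with
  | refl => exact Subset.rfl
  | tail _ hst ih => exact hst.subset.trans ih

/-- An elementary collapse of a good family is good. [folklore] -/
theorem CollapseStep.good {F G : Set (Finset E)} (h : CollapseStep F G) (hF : Good F) : Good G := by
  obtain ⟨σ, τ, ⟨hσ, hτ, hστ, hcard, huniq⟩, rfl⟩ := h
  refine ⟨fun he => hF.1 he.1, fun s hs t hts htne => ?_⟩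
  have hsF : s ∈ F := hs.1
  have hs' : s ≠ σ ∧ s ≠ τ := by simpa [mem_insert_iff] using hs.2
  refine ⟨hF.2 s hsF t hts htne, ?_⟩
  simp only [mem_insert_iff, mem_singleton_iff, not_or]
  constructor
  · rintro rfl
    have hss : t ⊂ s := lt_of_le_of_ne hts (fun h => hs'.1 h.symm)
    exact hs'.2 (huniq s hsF hss)
  · rintro rfl
    have hss : σ ⊂ s := lt_of_lt_of_le hστ hts
    exact hs'.2 (huniq s hsF hss)

/-- Linkedness is monotone in the face family. [folklore] -/
theorem Linked.mono [DecidableEq E] {F G : Set (Finset E)} (h : F ⊆ G) {u w : E} (hl : Linked F u w) :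
    Linked G u w := by
  induction hl with
  | refl => exact ReflTransGen.refl
  | tail _ hab ih => exact ih.tail (h hab)

/-- Linkedness is symmetric (edges are unordered pairs). [folklore] -/
theorem Linked.symm [DecidableEq E] {F : Set (Finset E)} {u w : E} (hl : Linked F u w) : Linked F w u := by
  induction hl with
  | refl => exact ReflTransGen.refl
  | tail _ hab ih =>
    refine ReflTransGen.head ?_ ih
    simpa [Finset.pair_comm] using hab

/-- **Collapsing to a vertex links every vertex to it.** If a good family `F` collapses to `{{w}}`,
every vertex of every member of `F` is joined to `w` by edges of `F`. [folklore] -/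
theorem linked_of_collapses [DecidableEq E] {F : Set (Finset E)} {w : E}
    (h : ReflTransGen CollapseStep F {({w} : Finset E)}) (hF : Good F) :
    ∀ s ∈ F, ∀ u ∈ s, Linked F u w := by
  induction h using ReflTransGen.head_induction_on with
  | refl =>
    intro s hs u hu
    have hs' : s = {w} := by simpa using hs
    subst hs'
    have hu' : u = w := by simpa using hu
    subst hu'
    exact ReflTransGen.refl
  | @head F' G' hstep _ ih =>
    intro s hs u hu
    have hG : Good G' := hstep.good hF
    have hGF : G' ⊆ F' := hstep.subset
    have ih' := ih hG
    have hu1 : ({u} : Finset E) ∈ F' := hF.2 s hs {u} (by simpa using hu) (Finset.singleton_nonempty u)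
    by_cases hcase : ({u} : Finset E) ∈ G'
    · exact (ih' {u} hcase u (Finset.mem_singleton_self u)).mono hGF
    · obtain ⟨σ, τ, ⟨hσ, hτ, hστ, hcard, huniq⟩, hG'⟩ := hstep
      have hor : ({u} : Finset E) = σ ∨ ({u} : Finset E) = τ := by
        by_contra hcon
        push Not at hcon
        apply hcase
        rw [hG']
        exact ⟨hu1, by simp [hcon.1, hcon.2]⟩
      rcases hor with hσu | hτu
      · -- `σ = {u}`, `τ = {u, q}` an edge of `F'`
        have hcard2 : τ.card = 2 := by rw [hcard, ← hσu, Finset.card_singleton]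
        obtain ⟨p, q, hpq, hτeq⟩ := Finset.card_eq_two.mp hcard2
        have huτ : u ∈ τ := hστ.subset (by simp [← hσu])
        -- the other endpoint
        obtain ⟨r, hru, hτur⟩ : ∃ r : E, r ≠ u ∧ τ = {u, r} := by
          rw [hτeq] at huτ
          rcases Finset.mem_insert.mp huτ with rfl | hq
          · exact ⟨q, hpq.symm, hτeq⟩
          · have : u = q := by simpa using hq
            subst this
            exact ⟨p, hpq, by rw [hτeq, Finset.pair_comm]⟩
        have hr1F : ({r} : Finset E) ∈ F' :=
          hF.2 τ hτ {r} (by simp [hτur]) (Finset.singleton_nonempty r)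
        have hr1G : ({r} : Finset E) ∈ G' := by
          rw [hG']
          refine ⟨hr1F, ?_⟩
          simp only [mem_insert_iff, mem_singleton_iff, not_or]
          constructor
          · rw [← hσu]
            intro h
            exact hru (Finset.singleton_injective h)
          · intro h
            have : ({r} : Finset E).card = 2 := by rw [h]; exact hcard2
            simp at this
        have hlr : Linked F' r w := (ih' {r} hr1G r (Finset.mem_singleton_self r)).mono hGF
        have hedge : ({u, r} : Finset E) ∈ F' := by rw [← hτur]; exact hτ
        exact ReflTransGen.head hedge hlr
      · -- `τ = {u}` would force `σ = ∅ ∈ F'`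
        exfalso
        have : σ = ∅ := by
          have h1 : σ ⊂ {u} := by rw [hτu]; exact hστ
          exact Finset.ssubset_singleton_iff.mp h1
        exact hF.1 (this ▸ hσ)

/-! ## From the combinatorics to the topology of `|K'|` -/

variable {N : ℕ}

/-- In a manifold modelled on `ℝ⁴`, no point is open. [folklore] -/
theorem not_isOpen_singleton_of_chartedSpace {M : Type*} [TopologicalSpace M]
    [ChartedSpace (EuclideanSpace ℝ (Fin 4)) M] (p : M) : ¬ IsOpen ({p} : Set M) := by
  intro hp
  have h1 : IsOpen ((chartAt (EuclideanSpace ℝ (Fin 4)) p) '' {p}) :=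
    (chartAt (EuclideanSpace ℝ (Fin 4)) p).isOpen_image_of_subset_source hp
      (singleton_subset_iff.mpr (mem_chart_source (EuclideanSpace ℝ (Fin 4)) p))
  rw [image_singleton] at h1
  have h2 := (isOpen_singleton_iff_punctured_nhds _).mp h1
  exact (Real.punctured_nhds_module_neBot (chartAt (EuclideanSpace ℝ (Fin 4)) p p)).ne h2

/-- **A skeleton certificate forces connectedness.** If a finite Euclidean simplicial complex `K'`
with `|K'| ≃ₜ M`, `M` a manifold modelled on `ℝ⁴`, has a vertex `v` whose antistar collapses to a
vertex `{w}` (the conclusion of `TropicalCollapse`, minus smoothness), then `M` is connected.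
[folklore] -/
theorem connectedSpace_of_certificate {M : Type*} [TopologicalSpace M]
    [ChartedSpace (EuclideanSpace ℝ (Fin 4)) M]
    (K' : SimplicialComplex ℝ (EuclideanSpace ℝ (Fin N))) (h' : K'.space ≃ₜ M)
    (hfin : K'.faces.Finite) (v w : EuclideanSpace ℝ (Fin N))
    (hcol : ReflTransGen CollapseStep {s ∈ K'.faces | v ∉ s} {({w} : Finset (EuclideanSpace ℝ (Fin N)))}) :
    ConnectedSpace M := by
  set A : Set (Finset (EuclideanSpace ℝ (Fin N))) := {s ∈ K'.faces | v ∉ s} with hA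
  have hAK : A ⊆ K'.faces := fun s hs => hs.1
  have hAgood : Good A := by
    refine ⟨fun he => K'.empty_notMem he.1, fun s hs t hts htne => ?_⟩
    exact ⟨K'.down_closed hs.1 hts htne, fun hvt => hs.2 (hts hvt)⟩
  have hwA : ({w} : Finset _) ∈ A := subset_of_collapses hcol (mem_singleton _)
  have hwK : ({w} : Finset _) ∈ K'.faces := hAK hwA
  have hlinkA := linked_of_collapses hcol hAgood
  -- every vertex of `K'` is linked to `w` in the edge graph of `K'`
  have hlink : ∀ u : EuclideanSpace ℝ (Fin N), ({u} : Finset _) ∈ K'.faces → Linked K'.faces u w := by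
    intro u hu
    by_cases huv : u = v
    · subst huv
      -- `u = v`: produce an edge `{u, q} ∈ K'` with `q ≠ u`, else `{u}` would be open in `|K'|`
      by_contra hnot
      have hiso : ∀ s ∈ K'.faces, u ∈ s → s = {u} := by
        intro s hs hus
        by_contra hne
        obtain ⟨q, hqs, hqu⟩ : ∃ q ∈ s, q ≠ u := by
          by_contra hall
          push Not at hall
          apply hne
          ext y
          constructor
          · intro hy; simpa using hall y hy
          · intro hy
            have : y = u := by simpa using hy
            subst this; exact hus
        have hedge : ({u, q} : Finset _) ∈ K'.faces :=
          K'.down_closed hs (by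
            intro y hy
            rcases Finset.mem_insert.mp hy with rfl | hy'
            · exact hus
            · have : y = q := by simpa using hy'
              subst this; exact hqs) (by simp)
        have hq1 : ({q} : Finset _) ∈ A :=
          ⟨K'.down_closed hs (by simpa using hqs) (Finset.singleton_nonempty q), by
            rw [Finset.mem_singleton]; exact fun h => hqu h.symm⟩
        exact hnot (ReflTransGen.head hedge ((hlinkA {q} hq1 q (by simp)).mono hAK))
      -- the closed set `C = ⋃_{s ∈ A} conv s` and `|K'| = {u} ∪ C` with `u ∉ C`
      set C : Set (EuclideanSpace ℝ (Fin N)) := ⋃ s ∈ A, convexHull ℝ (s : Set (EuclideanSpace ℝ (Fin N)))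
        with hC
      have hCclosed : IsClosed C := by
        refine (hfin.subset hAK).isClosed_biUnion fun s _ => ?_
        exact Set.Finite.isClosed_convexHull (𝕜 := ℝ) s.finite_toSet
      have huC : u ∉ C := by
        intro huC'
        obtain ⟨s, hsA, hus⟩ := mem_iUnion₂.mp huC'
        have := (K'.vertex_mem_convexHull_iff hu (hAK hsA)).mp hus
        exact hsA.2 this
      have huK : u ∈ K'.space := K'.subset_space hu (by simp)
      have hcover : ∀ y ∈ K'.space, y ∉ C → y = u := by
        intro y hy hyC
        obtain ⟨s, hs, hys⟩ := K'.mem_space_iff.mp hy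
        by_cases hvs : u ∈ s
        · have hs1 := hiso s hs hvs
          subst hs1
          simpa using hys
        · exact absurd (mem_iUnion₂.mpr ⟨s, ⟨hs, hvs⟩, hys⟩) hyC
      -- `{⟨u, _⟩}` is open in the subspace `|K'|`
      have hopen : IsOpen ({⟨u, huK⟩} : Set K'.space) := by
        have : ({⟨u, huK⟩} : Set K'.space) = ((↑) : K'.space → EuclideanSpace ℝ (Fin N)) ⁻¹' Cᶜ := by
          ext ⟨y, hy⟩
          simp only [mem_singleton_iff, Subtype.mk.injEq, mem_preimage, mem_compl_iff]
          exact ⟨fun h => h ▸ huC, fun h => hcover y hy h⟩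
        rw [this]
        exact hCclosed.isOpen_compl.preimage continuous_subtype_val
      have hopenM : IsOpen ({h' ⟨u, huK⟩} : Set M) := by
        simpa [image_singleton] using h'.isOpenMap _ hopen
      exact not_isOpen_singleton_of_chartedSpace _ hopenM
    · have hu1 : ({u} : Finset _) ∈ A := ⟨hu, by simpa [eq_comm] using huv⟩
      exact (hlinkA {u} hu1 u (by simp)).mono hAK
  -- chain the simplices through their vertices
  let R : Finset (EuclideanSpace ℝ (Fin N)) → Finset (EuclideanSpace ℝ (Fin N)) → Prop :=
    fun i j => (convexHull ℝ (i : Set (EuclideanSpace ℝ (Fin N))) ∩ convexHull ℝ (j : Set _)).Nonempty ∧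
      i ∈ K'.faces
  have hRvert : ∀ {a b : EuclideanSpace ℝ (Fin N)}, ({a} : Finset _) ∈ K'.faces → Linked K'.faces a b →
      ReflTransGen R {a} {b} := by
    intro a b ha hl
    induction hl with
    | refl => exact ReflTransGen.refl
    | @tail c d _ hedge ih =>
      have hc1 : ({c} : Finset _) ∈ K'.faces := K'.down_closed hedge (by simp) (by simp)
      have hd1 : ({d} : Finset _) ∈ K'.faces := K'.down_closed hedge (by simp) (by simp)
      refine (ih.tail ⟨⟨c, ?_⟩, hc1⟩).tail ⟨⟨d, ?_⟩, hedge⟩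
      · exact ⟨subset_convexHull ℝ _ (by simp), subset_convexHull ℝ _ (by simp)⟩
      · exact ⟨subset_convexHull ℝ _ (by simp), subset_convexHull ℝ _ (by simp)⟩
  have hchain : ∀ i, i ∈ K'.faces → ∀ j, j ∈ K'.faces → ReflTransGen R i j := by
    intro i hi j hj
    obtain ⟨a, ha⟩ := K'.nonempty_of_mem_faces hi
    obtain ⟨b, hb⟩ := K'.nonempty_of_mem_faces hj
    have ha1 : ({a} : Finset _) ∈ K'.faces := K'.down_closed hi (by simpa using ha) (by simp)
    have hb1 : ({b} : Finset _) ∈ K'.faces := K'.down_closed hj (by simpa using hb) (by simp)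
    have h1 : R i {a} := ⟨⟨a, subset_convexHull ℝ _ (by simpa using ha), subset_convexHull ℝ _ (by simp)⟩, hi⟩
    have h2 : ReflTransGen R {a} {w} := hRvert ha1 (hlink a ha1)
    have h3 : ReflTransGen R {w} {b} := hRvert hwK (hlink b hb1).symm
    have h4 : R {b} j := ⟨⟨b, subset_convexHull ℝ _ (by simp), subset_convexHull ℝ _ (by simpa using hb)⟩, hb1⟩
    exact (((ReflTransGen.single h1).trans h2).trans h3).tail h4
  have hpre : IsPreconnected K'.space :=
    IsPreconnected.biUnion_of_reflTransGen (fun s _ => (convex_convexHull ℝ _).isPreconnected) hchain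
  have hconn : IsConnected K'.space := ⟨⟨w, K'.subset_space hwK (by simp)⟩, hpre⟩
  haveI : ConnectedSpace K'.space := Subtype.connectedSpace hconn
  exact h'.connectedSpace_iff.mp inferInstance

/-! ## The hypothesis `H` and the negative lemma -/

/-- **`¬ TropicalCollapse` modulo `DisconnectedTropicalData`**: the typed crux quantifies over ALL
`C^∞` 4-manifolds `M`, connected or not, while its conclusion (a skeleton certificate) forces
`ConnectedSpace M` (`connectedSpace_of_certificate`). Class: misstated — repair by inserting
`[ConnectedSpace M]`; the disconnected witness misses the repaired statement. [folklore] -/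
theorem tropicalCollapse_false_of_disconnectedTropicalData :
    Literature.Topology.FourManifolds.DisconnectedTropicalData →
      ¬ Summit.SmoothPoincare4.SmoothPoincare4.Theses.TropicalFanoSkeleton.TropicalCollapse := by
  rintro ⟨M, _, _, _, _, _, hnc, N, K, h, hK, v₀, hv₀, x, hx⟩ hTC
  obtain ⟨N', K', h', hK', v, -, w, hcol⟩ := hTC M N K h hK v₀ hv₀ x hx
  exact hnc (connectedSpace_of_certificate K' h' hK'.1 v w hcol)

end Summit.SmoothPoincare4.SmoothPoincare4.Theorems.TropicalCollapse.Negative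

end
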